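/-
Copyright (c) 2026 the pub-hodgecm-mathlib formalisation cell (harness21).  Prover seat hodgecm-mathlib-K2Liu-p09 (g5): Track B «K2-LIT»,
hLiu418 = stmt-HodgeConjecture-24832; LEAD F0P6-plan RULINGS M-156m∕o, M-157a (4)∕c∕m «A7 = GK COCYCLE ROAD», file B7 (non-split place).
-/
import Summits.HodgeConjecture.HodgeConjecture.Theorems.K2LiuA7NormalisedRegularityMajorant   -- ★ B7-M2 (+ B7-M1, the chain, B7-S)
import Summits.HodgeConjecture.HodgeConjecture.Theorems.K2LiuSiegelIntertwiningCocycle      -- ★ B4d-3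
import Summits.HodgeConjecture.HodgeConjecture.Theorems.K2LiuA7NormaliserAlgebra            -- ★ B7-prep `eq_aNorm_two_mul`, `isQRationalRegularAt_normalisedFactor`
import Summits.HodgeConjecture.HodgeConjecture.Theorems.K2LiuFlatSiegelFamilies             -- ★ B2 (p14) `exists_uniform_level`, `isQRationalRegularAt_apply_of_flat`
import Literature.NumberTheory.Automorphic.AdelicSecondCountable                           -- ★ `secondCountableTopology_adicCompletion`
import HarnessLib

/-!
# Crux `HLiu418`, road `K2_Liu`, organ A7-reg (GK cocycle road), file B7 (non-split place):
# BAD-PLACE REGULARITY OF THE NORMALISED SIEGEL INTERTWINING OPERATOR AT `s = ½` — the (A4′-R) face at a place `v` with ONE place of `E` above it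

Cell `hodgecm-mathlib`, crux item hLiu418 = `stmt-HodgeConjecture-24832`; squad K2 ∕ K2Liu; prover K2Liu-p09 (g5).  THEOREMS ONLY; lane
`--supports stmt-HodgeConjecture-24832` (count-neutral helper).  ONE FRAME (RULING M-156o (c)): `φ := frameConj Q ∘ toLocalFour` (★ B1b-1, K2Liu-p03 (g6)); the
adapted-frame data `(D, Dinv, Q)` are hypotheses (the frame owner's bridge B8 supplies them for the CM datum).
THE POINT (RULING M-156m: A7 = the Gindikin–Karpelevich COCYCLE road; ⟦R-χ⟧ unitarity, ⟦R-Iw⟧ Iwasawa compact `K₀` as data, ⟦R-sm⟧ smoothness).  For `χ_v` unitary,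
a compact open `K₀ ≤ H_v` with `H_v = P_Δ(F_v) K₀`, and a family `f_s` of smooth Siegel sections of `I_v(s, χ_v)` flat on `K₀`, there is an EXPLICIT `Fn : ℂ → H_v → ℂ`,
each `s ↦ Fn s h` a rational function of `q_v^{-s}` regular at `½`, with **`M_v(s) f_s (h) = aNorm 2 χ_v (νN(N_Δ ∩ K₀)) s · Fn s h` on `1 < re s`**:
`M_v(s) = χ_s(m₀) · c_N · A₂ A₁ A₂` (★ B4d-3), each rank-one step `= L(e − 1, ν) ·` an explicit normalised family regular at `½` (★ B7-S, fed by ★ B4d-1b, ★ B7-CB, ★ B7-CC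
and integrable by ★ B7-M2), the numerators `L_F(2s+1, χ_F) · L_{E_w}(2s, χ_F∘N) · L_F(2s−1, χ_F)` recombine into `aNorm` (★ B7-prep `eq_aNorm_two_mul`) and the rest is
regular at `½` by unitarity (★ B7-prep `isQRationalRegularAt_normalisedFactor`).  This file: the place `v` has ONE place `w` of `E` above it (inert or ramified —
the BAD places included); the split case is the sequel `K2LiuA7NormalisedRegularitySplit`, and `K2LiuA7NormalisedRegularity` combines them (★ B7-R `placesOver_cases'`).
HONEST LABEL.  `HC_CM` is proved only modulo the 7 printed citations (2 remaining named inputs: hLiu418 = `stmt-HodgeConjecture-24832`,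
h413 = `stmt-HodgeConjecture-24833`) until rung 0 closes.

## References
* [KudlaSweet1997] S. Kudla, W. J. Sweet, *Degenerate principal series representations for U(n,n)*, Israel J. Math. 98 (1997), §1.
* [HarrisKudlaSweet1996] M. Harris, S. Kudla, W. J. Sweet, J. AMS 9 (1996), §6 (6.14)–(6.16) (the normalising factor `a_v(s)`).
* [Casselman1980] W. Casselman, *The unramified principal series of p-adic groups I*, Compositio Math. 40 (1980), §3 Thm. 3.1 (rank-one operators, cocycle).
-/

set_option autoImplicit false
set_option linter.dupNamespace false -- the mandated namespace repeats `HodgeConjecture.HodgeConjecture`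

noncomputable section

open scoped Classical NNReal ENNReal
open NumberField IsDedekindDomain Matrix MeasureTheory Topology
open Literature.NumberTheory.GaloisRepresentations.IsNonarchimedeanLocalField
open Literature.NumberTheory.Automorphic Literature.NumberTheory.Automorphic.UnitaryGroup
open Literature.NumberTheory.GelbartRogawski1991.AdaptedBlocks
open Literature.NumberTheory.GelbartRogawski1991.UnitaryDualPair.LocalSplitting
open Literature.NumberTheory.K2Lit.LocalSiegelDoubled
open Summit.HodgeConjecture.HodgeConjecture.Cruxes.HLiu418.K2LiuQRationalDefs
open Summit.HodgeConjecture.HodgeConjecture.Cruxes.HLiu418.K2LiuQRationalLFactor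
open Summit.HodgeConjecture.HodgeConjecture.Cruxes.HLiu418.K2LiuLocalLFactorDefs
open Summit.HodgeConjecture.HodgeConjecture.Cruxes.HLiu418.K2LiuLocalSiegelIwasawaFrame
open Summit.HodgeConjecture.HodgeConjecture.Cruxes.HLiu418.K2LiuLocalSiegelIwasawa
open Summit.HodgeConjecture.HodgeConjecture.Cruxes.HLiu418.K2LiuDoubledUTwoTwoBorelFrame
open Summit.HodgeConjecture.HodgeConjecture.Cruxes.HLiu418.K2LiuDoubledUTwoTwoWeylCocycle
open Summit.HodgeConjecture.HodgeConjecture.Cruxes.HLiu418.K2LiuDoubledUTwoTwoLevi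
open Summit.HodgeConjecture.HodgeConjecture.Cruxes.HLiu418.K2LiuDoubledUTwoTwoFrameTransport
open Summit.HodgeConjecture.HodgeConjecture.Cruxes.HLiu418.K2LiuDoubledUTwoTwoUnipotentHaar
open Summit.HodgeConjecture.HodgeConjecture.Cruxes.HLiu418.K2LiuDoubledUTwoTwoLeviTransport
open Summit.HodgeConjecture.HodgeConjecture.Cruxes.HLiu418.K2LiuUnipDeltaRankOneCoordinates
open Summit.HodgeConjecture.HodgeConjecture.Cruxes.HLiu418.K2LiuSiegelCocycleLetters
open Summit.HodgeConjecture.HodgeConjecture.Cruxes.HLiu418.K2LiuSiegelCocycleStageLetters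
open Summit.HodgeConjecture.HodgeConjecture.Cruxes.HLiu418.K2LiuSiegelCocycleStageShort
open Summit.HodgeConjecture.HodgeConjecture.Cruxes.HLiu418.K2LiuSiegelCocycleChainShort
open Summit.HodgeConjecture.HodgeConjecture.Cruxes.HLiu418.K2LiuSiegelCocycleChainLong
open Summit.HodgeConjecture.HodgeConjecture.Cruxes.HLiu418.K2LiuSiegelIntertwiningCocycle
open Summit.HodgeConjecture.HodgeConjecture.Cruxes.HLiu418.K2LiuRankOneStage
open Summit.HodgeConjecture.HodgeConjecture.Cruxes.HLiu418.K2LiuFlatSiegelFamilies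
open Summit.HodgeConjecture.HodgeConjecture.Cruxes.HLiu418.K2LiuLocalRingPlaceDecomposition
open Summit.HodgeConjecture.HodgeConjecture.Cruxes.HLiu418.K2LiuA7NormalisedRegularitySetup
open Summit.HodgeConjecture.HodgeConjecture.Cruxes.HLiu418.K2LiuA7NormalisedRegularityMajorant
open Summit.HodgeConjecture.HodgeConjecture.Cruxes.HLiu418.K2LiuA7NormaliserAlgebra

namespace Summit.HodgeConjecture.HodgeConjecture.Cruxes.HLiu418.K2LiuA7NormalisedRegularityNonsplit

variable (F : Type) [Field F] [NumberField F] (E : Type) [Field E] [NumberField E] [Algebra F E]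
  [Algebra.IsQuadraticExtension F E] (c : E ≃ₐ[F] E)
  {δ : E} (hcδ : c δ = -δ) (hδ : δ ≠ 0) {d : F} (hd : δ * δ = algebraMap F E d) (v : HeightOneSpectrum (𝓞 F))
  {T₂ : Matrix (Fin 2) (Fin 2) F} (hT₂ : T₂.IsSymm) {J₂D : Matrix (Fin (2 + 2)) (Fin (2 + 2)) E} (hJ₂D : J₂D = (gramD F 2 T₂).map (algebraMap F E))
  (D Dinv : Matrix (Fin 2) (Fin 2) F) (hDD : D * Dinv = 1) (hDD' : Dinv * D = 1) (Q : GL (Fin (2 + 2)) F)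
  (hQm : (Q : Matrix (Fin (2 + 2)) (Fin (2 + 2)) F) = Matrix.reindex (e₂ 2) (e₂ 2) (Matrix.fromBlocks 1 D 1 (-D)))
  (hQ : (Q : Matrix (Fin (2 + 2)) (Fin (2 + 2)) F)ᵀ * gramD F 2 T₂ * (Q : Matrix (Fin (2 + 2)) (Fin (2 + 2)) F) = (StdForm.antidiagonal (2 + 2)).over F)

include hcδ hδ hd hT₂ hDD hDD' hQm hQ in
/-- **(A4′-R) AT A NON-SPLIT PLACE — BAD-PLACE REGULARITY OF THE NORMALISED SIEGEL INTERTWINING OPERATOR AT `½`.**  For `χ_v` unitary, a compact open subgroup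
`K₀ ≤ H_v` with the Iwasawa property `H_v = P_Δ(F_v)·K₀`, and a family `f` of smooth Siegel sections of `I_v(s, χ_v)` whose restriction to `K₀` does not depend on `s`,
there is `Fn : ℂ → H_v → ℂ` with every `s ↦ Fn s h` rational in `q_v^{-s}` and regular at `½`, such that `M_v(s)(f s) h = aNorm 2 χ_v (νN(N_Δ ∩ K₀)) s · Fn s h` for
`1 < re s` — when `E` has one place above `v`. [cite: KudlaSweet1997, §1] [cite: HarrisKudlaSweet1996, §6 (6.14)–(6.16)] [cite: Casselman1980, §3 Thm. 3.1] -/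
theorem normalisedRegularity_of_forall_eq
    [MeasurableSpace (unipDeltaLocal F E c v 2 (JD := J₂D))] [BorelSpace (unipDeltaLocal F E c v 2 (JD := J₂D))]
    (νN : Measure (unipDeltaLocal F E c v 2 (JD := J₂D))) [νN.IsHaarMeasure]
    (χv : ∀ w : PlacesOver E v, (w.1.adicCompletion E)ˣ →* ℂˣ) (hχ : ∀ (w' : PlacesOver E v) (x : (w'.1.adicCompletion E)ˣ), ‖((χv w' x : ℂˣ) : ℂ)‖ = 1)
    (K₀ : Subgroup (UnitaryGroup.localPi E c (2 + 2) J₂D v))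
    (hK₀ : IsCompact (K₀ : Set (UnitaryGroup.localPi E c (2 + 2) J₂D v)) ∧ IsOpen (K₀ : Set (UnitaryGroup.localPi E c (2 + 2) J₂D v)))
    (hIw : ∀ g : UnitaryGroup.localPi E c (2 + 2) J₂D v, ∃ p, IsSiegelDelta F E c hcδ hδ hd v 2 hT₂ hJ₂D p ∧ ∃ k ∈ K₀, g = p * k)
    (f : ℂ → UnitaryGroup.localPi E c (2 + 2) J₂D v → ℂ) (hSieg : ∀ s, IsLocalSiegelSection F E c hcδ hδ hd v 2 hT₂ hJ₂D χv s (f s)) (hsm : ∀ s, IsSmooth F E c v 2 (f s))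
    (hflat : ∀ s s' : ℂ, ∀ k ∈ K₀, f s k = f s' k)
    (w : PlacesOver E v) (hw : ∀ w' : PlacesOver E v, w' = w) :
    ∃ Fn : ℂ → UnitaryGroup.localPi E c (2 + 2) J₂D v → ℂ,
      (∀ h, IsQRationalRegularAt (residueFieldCard (v.adicCompletion F)) (1 / 2) (fun s => Fn s h)) ∧
      ∀ s : ℂ, 1 < s.re → ∀ h : UnitaryGroup.localPi E c (2 + 2) J₂D v,
        localIntertwining F E c v 2 hJ₂D νN (f s) h = aNorm F E c v 2 χv (νN.real {u | (u : UnitaryGroup.localPi E c (2 + 2) J₂D v) ∈ K₀}) s * Fn s h := by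
  -- topology and measures on `F_v`, `E_w`, `E ⊗ F_v`
  haveI := secondCountableTopology_adicCompletion F v
  haveI : ∀ w' : PlacesOver E v, SecondCountableTopology (w'.1.adicCompletion E) := fun w' => secondCountableTopology_adicCompletion E w'.1
  borelize (v.adicCompletion F) (w.1.adicCompletion E) (UnitaryGroup.LocalRing E v)
  obtain ⟨μF, hμF⟩ : ∃ μ : Measure (v.adicCompletion F), μ.IsAddHaarMeasure := ⟨Measure.addHaar, inferInstance⟩
  obtain ⟨μw, hμw⟩ : ∃ μ : Measure (w.1.adicCompletion E), μ.IsAddHaarMeasure := ⟨Measure.addHaar, inferInstance⟩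
  obtain ⟨e₁, he₁, he₁add⟩ := exists_homeomorph_single_of_forall_eq F E v w hw
  have hmap : Measure.map (⇑e₁) μw = Measure.map (⇑e₁.toMeasurableEquiv) μw := by rw [Homeomorph.toMeasurableEquiv_coe]
  haveI hμR : (Measure.map (⇑e₁) μw).IsAddHaarMeasure :=
    AddEquiv.isAddHaarMeasure_map μw ({ toFun := e₁, invFun := e₁.symm, left_inv := e₁.symm_apply_apply, right_inv := e₁.apply_symm_apply, map_add' := he₁add } :
      w.1.adicCompletion E ≃+ UnitaryGroup.LocalRing E v) e₁.continuous e₁.symm.continuous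
  have hμRint : ∀ G : UnitaryGroup.LocalRing E v → ℂ, ∫ z, G z ∂(Measure.map (⇑e₁) μw) = ∫ ζ, G (Pi.single w ζ) ∂μw := fun G => by
    rw [hmap, integral_map_equiv]; simp only [Homeomorph.toMeasurableEquiv_coe, he₁]
  -- the coordinates of `N_Δ(F_v)` and the Haar relation
  obtain ⟨e3, he3'⟩ := exists_homeomorph_coordTwo F E c hcδ hδ v hJ₂D D Dinv hDD hDD' Q hQm hQ
  have he3 := he3'.1
  obtain ⟨cN, hcN, hν⟩ := exists_measure_eq_smul_map F E c v e3 he3'.2 νN μF (Measure.map (⇑e₁) μw)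
  -- one level for the whole family, regular values
  obtain ⟨K', -, hK'⟩ := exists_uniform_level F E c hcδ hδ hd v 2 hT₂ hJ₂D χv hSieg hflat hK₀.2 hIw (hsm 0)
  have hreg0 : ∀ h, IsQRationalRegularAt (residueFieldCard (v.adicCompletion F)) (1 / 2) fun s => f s h := fun h =>
    isQRationalRegularAt_apply_of_flat F E c hcδ hδ hd v 2 hT₂ hJ₂D χv hSieg hflat hIw h (1 / 2)
  -- the letters
  obtain ⟨A, hA⟩ := exists_partialWeylGL F E v w
  have huA := continuous_frameConj_uLongTwo_coord F E c hcδ hδ v hJ₂D Q hQ e3 he3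
  have hūA := continuous_ubar F E c hcδ hδ hd v hJ₂D Q hQ e3 he3
  have huBp := continuous_frameConj_uMinus_single F E c hcδ hδ v hJ₂D Q hQ w e3 he3
  have hūBp := continuous_ubar_single F E c hcδ hδ v hJ₂D Q hQ w e3 he3 (single_one_mul_single_one F E v w) A hA
  have huBadd : ∀ ζ ζ' : w.1.adicCompletion E, FrameTransport.frameConj F E c v (2 + 2) hJ₂D (antidiagonal_over_eq_map F E 2) Q hQ (toLocalFour F E c v (uMinus (UnitaryGroup.LocalRing E v) (UnitaryGroup.conjLocal E c v) (UnitaryGroup.conjLocal_conjLocal c v hcδ hδ) (Pi.single w (ζ + ζ')))) = FrameTransport.frameConj F E c v (2 + 2) hJ₂D (antidiagonal_over_eq_map F E 2) Q hQ (toLocalFour F E c v (uMinus (UnitaryGroup.LocalRing E v) (UnitaryGroup.conjLocal E c v) (UnitaryGroup.conjLocal_conjLocal c v hcδ hδ) (Pi.single w ζ))) * FrameTransport.frameConj F E c v (2 + 2) hJ₂D (antidiagonal_over_eq_map F E 2) Q hQ (toLocalFour F E c v (uMinus (UnitaryGroup.LocalRing E v) (UnitaryGroup.conjLocal E c v) (UnitaryGroup.conjLocal_conjLocal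 c v hcδ hδ) (Pi.single w ζ'))) :=
    fun ζ ζ' => by
      rw [show uMinus (UnitaryGroup.LocalRing E v) (UnitaryGroup.conjLocal E c v) (UnitaryGroup.conjLocal_conjLocal c v hcδ hδ) (Pi.single w (ζ + ζ')) =
          uMinus (UnitaryGroup.LocalRing E v) (UnitaryGroup.conjLocal E c v) (UnitaryGroup.conjLocal_conjLocal c v hcδ hδ) (Pi.single w ζ) * uMinus (UnitaryGroup.LocalRing E v) (UnitaryGroup.conjLocal E c v) (UnitaryGroup.conjLocal_conjLocal c v hcδ hδ) (Pi.single w ζ') by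
        rw [uMinus_mul, ← Pi.single_add], map_mul, map_mul]
  have hmid : ∀ (ζ : w.1.adicCompletion E) (g : UnitaryGroup.localPi E c (2 + 2) J₂D v), FrameTransport.frameConj F E c v (2 + 2) hJ₂D (antidiagonal_over_eq_map F E 2) Q hQ (toLocalFour F E c v (weylOne (UnitaryGroup.LocalRing E v) (UnitaryGroup.conjLocal E c v))) * FrameTransport.frameConj F E c v (2 + 2) hJ₂D (antidiagonal_over_eq_map F E 2) Q hQ (toLocalFour F E c v (uMinus (UnitaryGroup.LocalRing E v) (UnitaryGroup.conjLocal E c v) (UnitaryGroup.conjLocal_conjLocal c v hcδ hδ) (Pi.single w ζ))) * g = FrameTransport.frameConj F E c v (2 + 2) hJ₂D (antidiagonal_over_eq_map F E 2) Q hQ (toLocalFour F E c v (leviElt (UnitaryGroup.LocalRing E v) (UnitaryGroup.conjLocal E c v) (UnitaryGroup.conjLocal_conjLocal c v hcδ hδ) A)) * FrameTransport.frameConj F E c v (2 + 2) hJ₂D (antidiagonal_over_eq_map F E 2) Q hQ (toLocalFour F E c v (uMinus (UnitaryGroup.LocalRing E v) (UnitaryGroup.conjLocal E c v) (UnitaryGroup.conjLocal_conjLocal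 c v hcδ hδ) (Pi.single w ζ))) * g := by
    intro ζ g
    rw [← frameConj_partialWeyl_mul_uMinus_of_forall_eq F E c hcδ hδ v hJ₂D Q hQ hw A hA (Pi.single w ζ), Pi.single_eq_same]
  -- the residue cardinalities
  have hq0 : residueFieldCard (v.adicCompletion F) ≠ 0 := residueFieldCard_ne_zero _
  have hqw := residueFieldCard_placesOver_eq_pow (F := F) (E := E) (v := v) w
  -- STAGE A: `f ↦ N₁`, numerator `L_F(2s+1, χ_F)`
  have heA : ∀ s : ℂ, 1 < s.re → 1 < (((2 : ℕ) : ℂ) * s + 2).re := fun s hs => by simp; linarith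
  obtain ⟨N₁, hN₁reg, hN₁⟩ := exists_normalised_family μF f K'.isOpen (fun s _ g k hk => hK' s g k hk) huA
    (frameConj_uLongTwo_coord_zero F E c hcδ v hJ₂D Q hQ) hūA (ubar_zero F E c hcδ hδ hd v hJ₂D Q hQ) (frameConj_uLongTwo_coord_add F E c hcδ v hJ₂D Q hQ)
    (FrameTransport.frameConj F E c v (2 + 2) hJ₂D (antidiagonal_over_eq_map F E 2) Q hQ (toLocalFour F E c v (weylTwo (UnitaryGroup.LocalRing E v) (UnitaryGroup.conjLocal E c v)))) (chiF F E v χv) (norm_chiF_eq_one (F := F) (E := E) hχ) 2 2 heA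
    (fun s => localSiegelCharacter F E c v 2 χv s (FrameTransport.frameConj F E c v (2 + 2) hJ₂D (antidiagonal_over_eq_map F E 2) Q hQ (toLocalFour F E c v (torusElt (UnitaryGroup.LocalRing E v) (UnitaryGroup.conjLocal E c v) (UnitaryGroup.conjLocal_conjLocal c v hcδ hδ) 1 (-((Units.mk0 δ hδ).map (algebraMap E (UnitaryGroup.LocalRing E v) : E →* UnitaryGroup.LocalRing E v))⁻¹))))) (residueFieldCard (v.adicCompletion F)) 1 hq0 (pow_one _).symm
    (isQRationalRegularAt_localSiegelCharacter F E c hcδ hδ hd v 2 hT₂ hJ₂D χv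
      (isSiegelDelta_frameConj_torusElt F E c hcδ hδ hd v hT₂ hJ₂D D Dinv hDD Q hQm hQ 1 _) (1 / 2))
    (fun s _ x g => by simpa only [Nat.cast_ofNat] using apply_weylTwo_uLongTwo_coord_of_isLocalSiegelSection F E c hcδ hδ hd v hT₂ hJ₂D D Dinv hDD Q hQm hQ χv s (hSieg s) x g)
    hreg0
  have hLA : ∀ s : ℂ, 1 < s.re → lFactor F v (chiF F E v χv) (((2 : ℕ) : ℂ) * s + 2 - 1) ≠ 0 := fun s hs =>
    lFactor_ne_zero (norm_unramValue_le_one (norm_chiF_eq_one (F := F) (E := E) hχ)) (by simp; linarith)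
  have hN₁eq : ∀ s : ℂ, 1 < s.re → ∀ g, N₁ s g = (lFactor F v (chiF F E v χv) (((2 : ℕ) : ℂ) * s + 2 - 1))⁻¹ *
      ∫ y, f s (FrameTransport.frameConj F E c v (2 + 2) hJ₂D (antidiagonal_over_eq_map F E 2) Q hQ (toLocalFour F E c v (weylTwo (UnitaryGroup.LocalRing E v) (UnitaryGroup.conjLocal E c v))) * FrameTransport.frameConj F E c v (2 + 2) hJ₂D (antidiagonal_over_eq_map F E 2) Q hQ (toLocalFour F E c v (uLongTwo (UnitaryGroup.LocalRing E v) (UnitaryGroup.conjLocal E c v) (UnitaryGroup.toLocalRing E v y * algebraMap E (UnitaryGroup.LocalRing E v) δ) (conjLocal_coord F E c hcδ v y))) * g) ∂μF := fun s hs g => by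
    rw [(hN₁ s hs g).2, ← mul_assoc, inv_mul_cancel₀ (hLA s hs), one_mul]
  have hN₁K : ∀ s : ℂ, 1 < s.re → ∀ g, ∀ k ∈ (K' : Subgroup (UnitaryGroup.localPi E c (2 + 2) J₂D v)), N₁ s (g * k) = N₁ s g := fun s hs g k hk => by
    rw [hN₁eq s hs, hN₁eq s hs]
    exact congrArg _ (integral_congr_ae (Filter.Eventually.of_forall fun y => by simp only [← mul_assoc]; exact hK' s _ k hk))
  -- STAGE B: `N₁ ↦ N₂`, numerator `L_{E_w}(2s, χ_F ∘ N)`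
  have heB : ∀ s : ℂ, 1 < s.re → 1 < (((2 : ℕ) : ℂ) * s + 1).re := fun s hs => by simp; linarith
  obtain ⟨N₂, hN₂reg, hN₂⟩ := exists_normalised_family μw N₁ K'.isOpen hN₁K huBp.1 huBp.2 hūBp.1 hūBp.2 huBadd
    (FrameTransport.frameConj F E c v (2 + 2) hJ₂D (antidiagonal_over_eq_map F E 2) Q hQ (toLocalFour F E c v (leviElt (UnitaryGroup.LocalRing E v) (UnitaryGroup.conjLocal E c v) (UnitaryGroup.conjLocal_conjLocal c v hcδ hδ) A))) (chiNorm F E c v χv w) (norm_chiNorm_eq_one (F := F) (E := E) (c := c) hχ w) 2 1 heB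
    (fun _ => ((χv w (-1) : ℂˣ) : ℂ)) (residueFieldCard (v.adicCompletion F)) _ hq0 hqw (isQRationalRegularAt_const _ _ _)
    (fun s hs x g => by simpa only [Nat.cast_ofNat] using hrel_short F E c hcδ hδ hd v hT₂ hJ₂D D Dinv hDD Q hQm hQ μF χv s (hSieg s) _ (hN₁eq s hs) w A hA x g)
    hN₁reg
  have hLB : ∀ s : ℂ, 1 < s.re → lFactor E w.1 (chiNorm F E c v χv w) (((2 : ℕ) : ℂ) * s + 1 - 1) ≠ 0 := fun s hs =>
    lFactor_ne_zero (norm_unramValue_le_one (norm_chiNorm_eq_one (F := F) (E := E) (c := c) hχ w)) (by simp; linarith)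
  have hN₂eq : ∀ s : ℂ, 1 < s.re → ∀ g, N₂ s g = (lFactor E w.1 (chiNorm F E c v χv w) (((2 : ℕ) : ℂ) * s + 1 - 1))⁻¹ *
      ∫ ζ, N₁ s (FrameTransport.frameConj F E c v (2 + 2) hJ₂D (antidiagonal_over_eq_map F E 2) Q hQ (toLocalFour F E c v (leviElt (UnitaryGroup.LocalRing E v) (UnitaryGroup.conjLocal E c v) (UnitaryGroup.conjLocal_conjLocal c v hcδ hδ) A)) * FrameTransport.frameConj F E c v (2 + 2) hJ₂D (antidiagonal_over_eq_map F E 2) Q hQ (toLocalFour F E c v (uMinus (UnitaryGroup.LocalRing E v) (UnitaryGroup.conjLocal E c v) (UnitaryGroup.conjLocal_conjLocal c v hcδ hδ) (Pi.single w ζ))) * g) ∂μw := fun s hs g => by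
    rw [(hN₂ s hs g).2, ← mul_assoc, inv_mul_cancel₀ (hLB s hs), one_mul]
  have hN₂K : ∀ s : ℂ, 1 < s.re → ∀ g, ∀ k ∈ (K' : Subgroup (UnitaryGroup.localPi E c (2 + 2) J₂D v)), N₂ s (g * k) = N₂ s g := fun s hs g k hk => by
    rw [hN₂eq s hs, hN₂eq s hs]
    exact congrArg _ (integral_congr_ae (Filter.Eventually.of_forall fun ζ => by simp only [← mul_assoc]; exact hN₁K s hs _ k hk))
  -- STAGE C: `N₂ ↦ N₃`, numerator `L_F(2s−1, χ_F)`
  have heC : ∀ s : ℂ, 1 < s.re → 1 < (((2 : ℕ) : ℂ) * s + 0).re := fun s hs => by simp; linarith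
  obtain ⟨N₃, hN₃reg, hN₃⟩ := exists_normalised_family μF N₂ K'.isOpen hN₂K huA
    (frameConj_uLongTwo_coord_zero F E c hcδ v hJ₂D Q hQ) hūA (ubar_zero F E c hcδ hδ hd v hJ₂D Q hQ) (frameConj_uLongTwo_coord_add F E c hcδ v hJ₂D Q hQ)
    (FrameTransport.frameConj F E c v (2 + 2) hJ₂D (antidiagonal_over_eq_map F E 2) Q hQ (toLocalFour F E c v (weylTwo (UnitaryGroup.LocalRing E v) (UnitaryGroup.conjLocal E c v)))) (chiF F E v χv) (norm_chiF_eq_one (F := F) (E := E) hχ) 2 0 heC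
    (fun s => localSiegelCharacter F E c v 2 χv s (FrameTransport.frameConj F E c v (2 + 2) hJ₂D (antidiagonal_over_eq_map F E 2) Q hQ (toLocalFour F E c v (torusElt (UnitaryGroup.LocalRing E v) (UnitaryGroup.conjLocal E c v) (UnitaryGroup.conjLocal_conjLocal c v hcδ hδ) (-((Units.mk0 δ hδ).map (algebraMap E (UnitaryGroup.LocalRing E v) : E →* UnitaryGroup.LocalRing E v))⁻¹) 1))) * ((∏ w' : PlacesOver E v, ‖algebraMap E (UnitaryGroup.LocalRing E v) δ w'‖ : ℝ) : ℂ)) (residueFieldCard (v.adicCompletion F)) 1 hq0 (pow_one _).symm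
    ((isQRationalRegularAt_localSiegelCharacter F E c hcδ hδ hd v 2 hT₂ hJ₂D χv
      (isSiegelDelta_frameConj_torusElt F E c hcδ hδ hd v hT₂ hJ₂D D Dinv hDD Q hQm hQ _ 1) (1 / 2)).mul (isQRationalRegularAt_const _ _ _))
    (fun s hs x g => by
      rw [hrel_long_of_forall_eq F E c hcδ hδ hd v hT₂ hJ₂D D Dinv hDD Q hQm hQ μF χv s (hSieg s) _ (hN₁eq s hs) w hw μw A hA _ (hN₂eq s hs) x g]
      simp only [Nat.cast_ofNat, add_zero]; ring) hN₂reg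
  -- the volume factor and the Levi shift `m₀`
  have hvol := volume_inter_ne_zero F E c v 2 νN K₀ hK₀
  have hm₀ := isSiegelDelta_weylDelta_mul_frameConj_weylSiegel F E c hcδ hδ hd v hT₂ hJ₂D D Dinv hDD Q hQm hQ
  -- the answer
  refine ⟨fun s h => ((νN.real {u | (u : UnitaryGroup.localPi E c (2 + 2) J₂D v) ∈ K₀} : ℝ) : ℂ)⁻¹ * bDen F E c v 2 χv s * lF F E v χv (2 * s + 1) * lF F E v χv (2 * s) *
      (localSiegelCharacter F E c v 2 χv s (weylDelta F E c v 2 hJ₂D (T₀ := T₂) * FrameTransport.frameConj F E c v (2 + 2) hJ₂D (antidiagonal_over_eq_map F E 2) Q hQ (toLocalFour F E c v (weylSiegel (UnitaryGroup.LocalRing E v) (UnitaryGroup.conjLocal E c v)))) * ((cN : ℝ) : ℂ) * N₃ s h),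
    fun h => isQRationalRegularAt_normalisedFactor (c := c) (χv := χv) hχ _
      (((isQRationalRegularAt_localSiegelCharacter F E c hcδ hδ hd v 2 hT₂ hJ₂D χv hm₀ (1 / 2)).mul (isQRationalRegularAt_const _ _ _)).mul (hN₃reg h)),
    fun s hs h => ?_⟩
  have hs0 : 0 < s.re := by linarith
  -- the integral as an iterated integral (★ B4d-3 with the majorant chain ★ B7-M2)
  have hch := chain_integrability_of_forall_eq F E c hcδ hδ hd v hT₂ hJ₂D D Dinv hDD Q hQm hQ μF e3 he3 hχ hs (hSieg s) (hsm s) K' (hK' s) w hw μw e₁ he₁ A hA h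
  rw [localIntertwining_eq_mul_integral_frameConj F E c hcδ hδ hd v hT₂ hJ₂D D Dinv hDD Q hQm hQ νN χv s (hSieg s) h,
    (integral_frameConj_weylSiegel_eq_iterated_of_chain F E c hcδ hδ v hJ₂D Q hQ e3 he3 νN μF (Measure.map (⇑e₁) μw) cN hν (f s) h
      hch.1 hch.2.1 hch.2.2.1 hch.2.2.2).2]
  -- evaluate the three stages
  have inner : ∀ (x : v.adicCompletion F) (z : UnitaryGroup.LocalRing E v),
      ∫ y, f s (FrameTransport.frameConj F E c v (2 + 2) hJ₂D (antidiagonal_over_eq_map F E 2) Q hQ (toLocalFour F E c v (weylTwo (UnitaryGroup.LocalRing E v) (UnitaryGroup.conjLocal E c v))) * FrameTransport.frameConj F E c v (2 + 2) hJ₂D (antidiagonal_over_eq_map F E 2) Q hQ (toLocalFour F E c v (uLongTwo (UnitaryGroup.LocalRing E v) (UnitaryGroup.conjLocal E c v) (UnitaryGroup.toLocalRing E v y * algebraMap E (UnitaryGroup.LocalRing E v) δ) (conjLocal_coord F E c hcδ v y))) *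
            (FrameTransport.frameConj F E c v (2 + 2) hJ₂D (antidiagonal_over_eq_map F E 2) Q hQ (toLocalFour F E c v (weylOne (UnitaryGroup.LocalRing E v) (UnitaryGroup.conjLocal E c v))) * FrameTransport.frameConj F E c v (2 + 2) hJ₂D (antidiagonal_over_eq_map F E 2) Q hQ (toLocalFour F E c v (uMinus (UnitaryGroup.LocalRing E v) (UnitaryGroup.conjLocal E c v) (UnitaryGroup.conjLocal_conjLocal c v hcδ hδ) z)) *
              (FrameTransport.frameConj F E c v (2 + 2) hJ₂D (antidiagonal_over_eq_map F E 2) Q hQ (toLocalFour F E c v (weylTwo (UnitaryGroup.LocalRing E v) (UnitaryGroup.conjLocal E c v))) * FrameTransport.frameConj F E c v (2 + 2) hJ₂D (antidiagonal_over_eq_map F E 2) Q hQ (toLocalFour F E c v (uLongTwo (UnitaryGroup.LocalRing E v) (UnitaryGroup.conjLocal E c v) (UnitaryGroup.toLocalRing E v x * algebraMap E (UnitaryGroup.LocalRing E v) δ) (conjLocal_coord F E c hcδ v x))) * h))) ∂μF =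
        lFactor F v (chiF F E v χv) (((2 : ℕ) : ℂ) * s + 2 - 1) * N₁ s (FrameTransport.frameConj F E c v (2 + 2) hJ₂D (antidiagonal_over_eq_map F E 2) Q hQ (toLocalFour F E c v (weylOne (UnitaryGroup.LocalRing E v) (UnitaryGroup.conjLocal E c v))) * FrameTransport.frameConj F E c v (2 + 2) hJ₂D (antidiagonal_over_eq_map F E 2) Q hQ (toLocalFour F E c v (uMinus (UnitaryGroup.LocalRing E v) (UnitaryGroup.conjLocal E c v) (UnitaryGroup.conjLocal_conjLocal c v hcδ hδ) z)) *
              (FrameTransport.frameConj F E c v (2 + 2) hJ₂D (antidiagonal_over_eq_map F E 2) Q hQ (toLocalFour F E c v (weylTwo (UnitaryGroup.LocalRing E v) (UnitaryGroup.conjLocal E c v))) * FrameTransport.frameConj F E c v (2 + 2) hJ₂D (antidiagonal_over_eq_map F E 2) Q hQ (toLocalFour F E c v (uLongTwo (UnitaryGroup.LocalRing E v) (UnitaryGroup.conjLocal E c v) (UnitaryGroup.toLocalRing E v x * algebraMap E (UnitaryGroup.LocalRing E v) δ) (conjLocal_coord F E c hcδ v x))) * h)) := fun x z => (hN₁ s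 hs _).2
  have middle : ∀ x : v.adicCompletion F,
      ∫ z, lFactor F v (chiF F E v χv) (((2 : ℕ) : ℂ) * s + 2 - 1) * N₁ s (FrameTransport.frameConj F E c v (2 + 2) hJ₂D (antidiagonal_over_eq_map F E 2) Q hQ (toLocalFour F E c v (weylOne (UnitaryGroup.LocalRing E v) (UnitaryGroup.conjLocal E c v))) * FrameTransport.frameConj F E c v (2 + 2) hJ₂D (antidiagonal_over_eq_map F E 2) Q hQ (toLocalFour F E c v (uMinus (UnitaryGroup.LocalRing E v) (UnitaryGroup.conjLocal E c v) (UnitaryGroup.conjLocal_conjLocal c v hcδ hδ) z)) *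
              (FrameTransport.frameConj F E c v (2 + 2) hJ₂D (antidiagonal_over_eq_map F E 2) Q hQ (toLocalFour F E c v (weylTwo (UnitaryGroup.LocalRing E v) (UnitaryGroup.conjLocal E c v))) * FrameTransport.frameConj F E c v (2 + 2) hJ₂D (antidiagonal_over_eq_map F E 2) Q hQ (toLocalFour F E c v (uLongTwo (UnitaryGroup.LocalRing E v) (UnitaryGroup.conjLocal E c v) (UnitaryGroup.toLocalRing E v x * algebraMap E (UnitaryGroup.LocalRing E v) δ) (conjLocal_coord F E c hcδ v x))) * h)) ∂(Measure.map (⇑e₁) μw) =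
        lFactor F v (chiF F E v χv) (((2 : ℕ) : ℂ) * s + 2 - 1) * (lFactor E w.1 (chiNorm F E c v χv w) (((2 : ℕ) : ℂ) * s + 1 - 1) *
          N₂ s (FrameTransport.frameConj F E c v (2 + 2) hJ₂D (antidiagonal_over_eq_map F E 2) Q hQ (toLocalFour F E c v (weylTwo (UnitaryGroup.LocalRing E v) (UnitaryGroup.conjLocal E c v))) * FrameTransport.frameConj F E c v (2 + 2) hJ₂D (antidiagonal_over_eq_map F E 2) Q hQ (toLocalFour F E c v (uLongTwo (UnitaryGroup.LocalRing E v) (UnitaryGroup.conjLocal E c v) (UnitaryGroup.toLocalRing E v x * algebraMap E (UnitaryGroup.LocalRing E v) δ) (conjLocal_coord F E c hcδ v x))) * h)) := fun x => by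
    rw [hμRint, integral_const_mul]
    simp only [hmid]
    rw [(hN₂ s hs _).2]
  have outer : ∫ x, lFactor F v (chiF F E v χv) (((2 : ℕ) : ℂ) * s + 2 - 1) * (lFactor E w.1 (chiNorm F E c v χv w) (((2 : ℕ) : ℂ) * s + 1 - 1) *
          N₂ s (FrameTransport.frameConj F E c v (2 + 2) hJ₂D (antidiagonal_over_eq_map F E 2) Q hQ (toLocalFour F E c v (weylTwo (UnitaryGroup.LocalRing E v) (UnitaryGroup.conjLocal E c v))) * FrameTransport.frameConj F E c v (2 + 2) hJ₂D (antidiagonal_over_eq_map F E 2) Q hQ (toLocalFour F E c v (uLongTwo (UnitaryGroup.LocalRing E v) (UnitaryGroup.conjLocal E c v) (UnitaryGroup.toLocalRing E v x * algebraMap E (UnitaryGroup.LocalRing E v) δ) (conjLocal_coord F E c hcδ v x))) * h)) ∂μF =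
        lFactor F v (chiF F E v χv) (((2 : ℕ) : ℂ) * s + 2 - 1) * (lFactor E w.1 (chiNorm F E c v χv w) (((2 : ℕ) : ℂ) * s + 1 - 1) *
          (lFactor F v (chiF F E v χv) (((2 : ℕ) : ℂ) * s + 0 - 1) * N₃ s h)) := by
    rw [integral_const_mul, integral_const_mul, (hN₃ s hs h).2]
  simp_rw [inner, middle]
  rw [outer]
  -- the three numerators are `L_F(2s+1) L_{E/F}(2s) L_F(2s−1)`; recombine into `aNorm`
  have hL1 : lFactor F v (chiF F E v χv) (((2 : ℕ) : ℂ) * s + 2 - 1) = lF F E v χv (2 * s + 1) := by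
    rw [lF]; congr 1; push_cast; ring
  have hL2 : lFactor E w.1 (chiNorm F E c v χv w) (((2 : ℕ) : ℂ) * s + 1 - 1) = lEN F E c v χv (2 * s) := by
    rw [lEN, Fintype.prod_eq_single w fun w' hw' => absurd (hw w') hw']; congr 1; push_cast; ring
  have hL3 : lFactor F v (chiF F E v χv) (((2 : ℕ) : ℂ) * s + 0 - 1) = lF F E v χv (2 * s - 1) := by
    rw [lF]; congr 1; push_cast; ring
  rw [hL1, hL2, hL3]
  have key := eq_aNorm_two_mul (c := c) (χv := χv) hχ hvol hs0 (localSiegelCharacter F E c v 2 χv s (weylDelta F E c v 2 hJ₂D (T₀ := T₂) * FrameTransport.frameConj F E c v (2 + 2) hJ₂D (antidiagonal_over_eq_map F E 2) Q hQ (toLocalFour F E c v (weylSiegel (UnitaryGroup.LocalRing E v) (UnitaryGroup.conjLocal E c v)))) * ((cN : ℝ) : ℂ)) (N₃ s h)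
  calc _ = localSiegelCharacter F E c v 2 χv s (weylDelta F E c v 2 hJ₂D (T₀ := T₂) * FrameTransport.frameConj F E c v (2 + 2) hJ₂D (antidiagonal_over_eq_map F E 2) Q hQ (toLocalFour F E c v (weylSiegel (UnitaryGroup.LocalRing E v) (UnitaryGroup.conjLocal E c v)))) * ((cN : ℝ) : ℂ) *
        lF F E v χv (2 * s + 1) * lEN F E c v χv (2 * s) * lF F E v χv (2 * s - 1) * N₃ s h := by ring
    _ = _ := key

end Summit.HodgeConjecture.HodgeConjecture.Cruxes.HLiu418.K2LiuA7NormalisedRegularityNonsplit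

end
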